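import Summits.Ventures.PercRepro.S1CoreCapEightThreeMeet

/-!
# PercRepro — TOWARDS `Q*(8)`: TWO DISJOINT BIG LINES WITH CHORD-UNIQUE HUBS, AND THEIR PLANE (p1, gen 28)

The two devices of the sub-configuration trick for the case (A0) of the last open case at nullity `8`.
(1) `sum_cap_le_eighteen_of_two_big_chord_unique`: the body of `S1CoreCapEightTwoNon` with the two consequences
of non-coplanarity — the two big lines are disjoint and no point off them carries two of their chords — taken as
hypotheses: cap sum `≤ 18`. (2) `subset_plane_of_two_chords`: for two disjoint big lines `A, B` and a hub `v` with
two chords `Y, Y′`, the list `[B, Y′, Y, A]` has `lineRank 3` and its union is `A ∪ B ∪ {v}` (at least nine points,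
at most nine by the plane clause), so every line of the configuration with two points on `A ∪ B ∪ {v}` lies in it
(`chord_structure`: a chord meets each line once and is `{v}` off them). `proofs/P1-S4-CAPBRIDGE.md` §20.
Axioms: standard.
-/

namespace PercRepro

namespace S1

namespace FourCap

namespace Eight

open Seven

variable {β : Type} [DecidableEq β]

section TwoBigChordUnique

variable {w : β → ℕ} {ls : Finset (Finset β)}
  (h1 : ∀ L ∈ ls, ∀ v ∈ L, w v = 1 ∨ w v = 2)
  (h2 : ∀ L ∈ ls, 3 ≤ L.card ∧ wsum w L ≤ 5)
  (h3 : ∀ L ∈ ls, ∀ L' ∈ ls, L ≠ L' → (L ∩ L').card ≤ 1)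
  (h4 : ∀ l : List (Finset β), l.Nodup → (∀ L ∈ l, L ∈ ls) → wsum w (unionL l) ≤ 8 + lineRank l)
  {L₁ L₂ : Finset β} (hL₁ : L₁ ∈ ls) (hL₂ : L₂ ∈ ls) (h12 : L₂ ≠ L₁)
  (c1 : 4 ≤ L₁.card) (c2 : 4 ≤ L₂.card)
  (hrest : ∀ L ∈ ls, L ≠ L₁ → L ≠ L₂ → L.card = 3)
  (hdisj : (L₂ ∩ L₁).card = 0)
  (hone : ∀ v, v ∉ L₁ ∪ L₂ → ∀ c ∈ ls, ∀ c' ∈ ls, c ≠ L₁ → c ≠ L₂ → c' ≠ L₁ → c' ≠ L₂ → v ∈ c → v ∈ c' →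
    (c ∩ (L₁ ∪ L₂)).card = 2 → (c' ∩ (L₁ ∪ L₂)).card = 2 → c = c')

include h1 h2 h3 h4 hL₁ hL₂ h12 c1 c2 hrest hdisj hone in
/-- **Two disjoint big lines with at most one chord through each hub, at nullity `8`: cap sum `≤ 18`** (the
body of `sum_cap_le_eighteen_of_two_big_noncoplanar` with the two consequences of non-coplanarity as
hypotheses). -/
theorem sum_cap_le_eighteen_of_two_big_chord_unique : ∑ L ∈ ls, capPaper L.card (fat w L) ≤ 18 := by
  have h2' := two_le_card_of_spec₇ h2
  set T := (ls.erase L₁).erase L₂ with hT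
  have hTmem : ∀ L ∈ T, L ∈ ls ∧ L ≠ L₁ ∧ L ≠ L₂ := fun L hL => by
    have h2'' := Finset.mem_erase.1 hL
    have h1' := Finset.mem_erase.1 h2''.2
    exact ⟨h1'.2, h1'.1, h2''.1⟩
  have hT3 : ∀ L ∈ T, L.card = 3 := fun L hL => hrest L (hTmem L hL).1 (hTmem L hL).2.1 (hTmem L hL).2.2
  -- the budget over `L₂ ∪ L₁`
  have hk : ∀ t : List (Finset β), t.Nodup → (∀ L ∈ t, L ∈ T) →
      freeCountR (L₂ ∪ L₁) t + fat w (unionLR (L₂ ∪ L₁) t \ (L₂ ∪ L₁)) + L₁.card + L₂.card + fat w L₁ +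
        fat w L₂ ≤ 12 := by
    intro t hndt hlt
    have hb := budget_of_prefix h1 h2' h4 [L₂, L₁] t (by
      rw [List.nodup_append']
      refine ⟨hndt, by simp [h12], fun L hLt hLl => ?_⟩
      simp only [List.mem_cons, List.not_mem_nil, or_false] at hLl
      rcases hLl with rfl | rfl
      · exact (hTmem L (hlt L hLt)).2.2 rfl
      · exact (hTmem L (hlt L hLt)).2.1 rfl)
      (fun L hL => by
        rcases List.mem_append.1 hL with hL | hL
        · exact (hTmem L (hlt L hL)).1
        · simp only [List.mem_cons, List.not_mem_nil, or_false] at hL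
          rcases hL with rfl | rfl
          · exact hL₂
          · exact hL₁)
      (fun L hL => hT3 L (hlt L hL))
    simp only [unionL, costSum, Finset.union_empty, Nat.zero_add, lineCost_empty] at hb
    rw [lineCost_of_inter_le_two (by omega)] at hb
    have hsplit := fat_sdiff_add_fat_of_subset w (subset_unionLR (L₂ ∪ L₁) t)
    have hdisj' : Disjoint L₂ L₁ := Finset.disjoint_iff_inter_eq_empty.2 (Finset.card_eq_zero.1 hdisj)
    have hf12 : fat w (L₂ ∪ L₁) = fat w L₂ + fat w L₁ := by
      unfold fat
      rw [Finset.filter_union, Finset.card_union_of_disjoint (Finset.disjoint_filter_filter hdisj')]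
    have hsd : L₂ \ L₁ = L₂ := Finset.sdiff_eq_self_of_disjoint hdisj'
    rw [hsd] at hb
    omega
  -- the family with chords
  have hthin := two_mul_sum_cap_chord_le w (L₂ ∪ L₁) T (b := 12 - L₁.card - L₂.card - fat w L₁ - fat w L₂)
    (fun L hL => ⟨hT3 L hL, by
      have := card_inter_union_le L L₂ L₁
      have := h3 L (hTmem L hL).1 L₂ hL₂ (hTmem L hL).2.2
      have := h3 L (hTmem L hL).1 L₁ hL₁ (hTmem L hL).2.1
      omega⟩)
    (fun L hL L' hL' hne => h3 L (hTmem L hL).1 L' (hTmem L' hL').1 hne)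
    (fun v hv L hL L' hL' hvL hvL' hLP hL'P => by
      rw [Finset.union_comm] at hv hLP hL'P
      exact hone v hv L (hTmem L hL).1 L' (hTmem L' hL').1 (hTmem L hL).2.1 (hTmem L hL).2.2
        (hTmem L' hL').2.1 (hTmem L' hL').2.2 hvL hvL' hLP hL'P)
    (fun L hL => h1 L (hTmem L hL).1) (fun L hL => (h2 L (hTmem L hL).1).2)
    (fun t hndt hlt => by have := hk t hndt hlt; omega)
  -- the sum
  have hsum := Finset.add_sum_erase ls (fun L => capPaper L.card (fat w L)) hL₁
  have hsum' := Finset.add_sum_erase (ls.erase L₁) (fun L => capPaper L.card (fat w L))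
    (Finset.mem_erase.2 ⟨h12, hL₂⟩)
  rw [← hT] at hsum'
  rw [← hsum, ← hsum']
  have hcap1 := capPaper_big_eq h1 h2 hL₁ c1
  have hcap2 := capPaper_big_eq h1 h2 hL₂ c2
  rw [hcap1, hcap2]
  have hw1 := (h2 L₁ hL₁).2
  have hw2 := (h2 L₂ hL₂).2
  have hwa := wsum_eq_card_add_fat w L₁ (h1 L₁ hL₁)
  have hwb := wsum_eq_card_add_fat w L₂ (h1 L₂ hL₂)
  have hdisj' : Disjoint L₂ L₁ := Finset.disjoint_iff_inter_eq_empty.2 (Finset.card_eq_zero.1 hdisj)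
  have hf12 : fat w (L₂ ∪ L₁) = fat w L₂ + fat w L₁ := by
    unfold fat
    rw [Finset.filter_union, Finset.card_union_of_disjoint (Finset.disjoint_filter_filter hdisj')]
  rw [hf12] at hthin
  have hs1 : (L₁.card = 4 ∧ fat w L₁ = 0) ∨ (L₁.card = 5 ∧ fat w L₁ = 0) ∨ (L₁.card = 4 ∧ fat w L₁ = 1) := by
    omega
  have hs2 : (L₂.card = 4 ∧ fat w L₂ = 0) ∨ (L₂.card = 5 ∧ fat w L₂ = 0) ∨ (L₂.card = 4 ∧ fat w L₂ = 1) := by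
    omega
  rcases hs1 with ⟨hk1, ha⟩ | ⟨hk1, ha⟩ | ⟨hk1, ha⟩ <;> rcases hs2 with ⟨hk2, hb⟩ | ⟨hk2, hb⟩ | ⟨hk2, hb⟩ <;>
    rw [hk1, hk2, ha, hb] at hthin ⊢ <;> omega

end TwoBigChordUnique

section Plane

variable {ls : Finset (Finset β)}
  (h3 : ∀ L ∈ ls, ∀ L' ∈ ls, L ≠ L' → (L ∩ L').card ≤ 1)
  (h5 : ∀ l : List (Finset β), l.Nodup → (∀ L ∈ l, L ∈ ls) → lineRank l ≤ 3 → (unionL l).card ≤ 9)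

/-- A chord of two disjoint lines through a hub: it meets each line once and lies in `A ∪ B ∪ {v}`. -/
theorem chord_structure {A B Y : Finset β} {v : β} (hY3 : Y.card = 3) (hYA : (Y ∩ A).card ≤ 1)
    (hYB : (Y ∩ B).card ≤ 1) (hv : v ∉ A ∪ B) (hvY : v ∈ Y) (hY2 : (Y ∩ (A ∪ B)).card = 2) :
    (Y ∩ A).card = 1 ∧ (Y ∩ B).card = 1 ∧ Y ⊆ A ∪ B ∪ {v} := by
  have hu := card_inter_union_le Y A B
  have hsd := Finset.card_sdiff_add_card_inter Y (A ∪ B)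
  have hv' : Y \ (A ∪ B) = {v} := by
    have hmem : v ∈ Y \ (A ∪ B) := Finset.mem_sdiff.2 ⟨hvY, hv⟩
    have hc : (Y \ (A ∪ B)).card = 1 := by omega
    obtain ⟨u, hu'⟩ := Finset.card_eq_one.1 hc
    rw [hu'] at hmem ⊢
    rw [Finset.mem_singleton.1 hmem]
  refine ⟨by omega, by omega, fun u hu => ?_⟩
  by_cases huAB : u ∈ A ∪ B
  · exact Finset.mem_union_left _ huAB
  · have : u ∈ Y \ (A ∪ B) := Finset.mem_sdiff.2 ⟨hu, huAB⟩
    rw [hv'] at this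
    exact Finset.mem_union_right _ this

include h3 h5 in
/-- **The plane on two disjoint big lines and a hub with two chords is exactly `A ∪ B ∪ {v}`**: every line of
the configuration with two points on `A ∪ B ∪ {v}` lies in it (a tenth point would violate the plane clause on
`[X, B, Y′, Y, A]`). -/
theorem subset_plane_of_two_chords {A B Y Y' : Finset β} (hA : A ∈ ls) (hB : B ∈ ls) (hBA : B ≠ A)
    (cA : 4 ≤ A.card) (cB : 4 ≤ B.card) (hdisj : (B ∩ A).card = 0) {v : β} (hv : v ∉ A ∪ B)
    (hY : Y ∈ ls) (hY' : Y' ∈ ls) (hYY' : Y ≠ Y') (hYA : Y ≠ A) (hYB : Y ≠ B) (hY'A : Y' ≠ A) (hY'B : Y' ≠ B)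
    (hY3 : Y.card = 3) (hY'3 : Y'.card = 3) (hvY : v ∈ Y) (hvY' : v ∈ Y')
    (hY2 : (Y ∩ (A ∪ B)).card = 2) (hY'2 : (Y' ∩ (A ∪ B)).card = 2) :
    ∀ X ∈ ls, 2 ≤ (X ∩ (A ∪ B ∪ {v})).card → X ⊆ A ∪ B ∪ {v} := by
  intro X hX hX2
  obtain ⟨hYA1, hYB1, hYsub⟩ := chord_structure hY3 (h3 Y hY A hA hYA) (h3 Y hY B hB hYB) hv hvY hY2
  obtain ⟨hY'A1, hY'B1, hY'sub⟩ := chord_structure hY'3 (h3 Y' hY' A hA hY'A) (h3 Y' hY' B hB hY'B) hv hvY' hY'2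
  have hAsub : A ⊆ A ∪ B ∪ {v} := fun u hu => Finset.mem_union_left _ (Finset.mem_union_left _ hu)
  have hBsub : B ⊆ A ∪ B ∪ {v} := fun u hu => Finset.mem_union_left _ (Finset.mem_union_right _ hu)
  by_cases hXeq : X = A ∨ X = B ∨ X = Y ∨ X = Y'
  · rcases hXeq with rfl | rfl | rfl | rfl
    · exact hAsub
    · exact hBsub
    · exact hYsub
    · exact hY'sub
  push Not at hXeq
  obtain ⟨hXA, hXB, hXY, hXY'⟩ := hXeq
  -- the plane
  have hr1 : lineRank [Y, A] = 3 := lineRank_pair_eq_three (by omega) (by omega) hYA1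
  have hr2 : lineRank [Y', Y, A] = 3 := by
    rw [lineRank_cons_of_two_le Y' [Y, A] ?_, hr1]
    obtain ⟨a', ha'⟩ := Finset.card_eq_one.1 hY'A1
    have ha'Y' : a' ∈ Y' ∩ A := ha' ▸ Finset.mem_singleton_self a'
    have hne : v ≠ a' := fun e => hv (Finset.mem_union_left _ (e ▸ (Finset.mem_inter.1 ha'Y').2))
    have hsub : ({v, a'} : Finset β) ⊆ Y' ∩ unionL [Y, A] := by
      intro u hu
      simp only [Finset.mem_insert, Finset.mem_singleton] at hu
      simp only [unionL, Finset.union_empty]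
      rcases hu with rfl | rfl
      · exact Finset.mem_inter.2 ⟨hvY', Finset.mem_union_left _ hvY⟩
      · exact Finset.mem_inter.2 ⟨(Finset.mem_inter.1 ha'Y').1, Finset.mem_union_right _ (Finset.mem_inter.1 ha'Y').2⟩
    have := Finset.card_le_card hsub
    rwa [Finset.card_pair hne] at this
  have hr3 : lineRank [B, Y', Y, A] = 3 := by
    rw [lineRank_cons_of_two_le B [Y', Y, A] ?_, hr2]
    obtain ⟨b, hb⟩ := Finset.card_eq_one.1 hYB1
    obtain ⟨b', hb'⟩ := Finset.card_eq_one.1 hY'B1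
    have hbY : b ∈ Y ∩ B := hb ▸ Finset.mem_singleton_self b
    have hb'Y' : b' ∈ Y' ∩ B := hb' ▸ Finset.mem_singleton_self b'
    have hne : b ≠ b' := by
      intro e
      have hsub : ({v, b} : Finset β) ⊆ Y ∩ Y' := by
        intro u hu
        simp only [Finset.mem_insert, Finset.mem_singleton] at hu
        rcases hu with rfl | rfl
        · exact Finset.mem_inter.2 ⟨hvY, hvY'⟩
        · exact Finset.mem_inter.2 ⟨(Finset.mem_inter.1 hbY).1, e ▸ (Finset.mem_inter.1 hb'Y').1⟩
      have hvb : v ≠ b := fun e' => hv (Finset.mem_union_right _ (e' ▸ (Finset.mem_inter.1 hbY).2))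
      have := Finset.card_le_card hsub
      rw [Finset.card_pair hvb] at this
      have := h3 Y hY Y' hY' hYY'
      omega
    have hsub : ({b, b'} : Finset β) ⊆ B ∩ unionL [Y', Y, A] := by
      intro u hu
      simp only [Finset.mem_insert, Finset.mem_singleton] at hu
      simp only [unionL, Finset.union_empty]
      rcases hu with rfl | rfl
      · exact Finset.mem_inter.2 ⟨(Finset.mem_inter.1 hbY).2,
          Finset.mem_union_right _ (Finset.mem_union_left _ (Finset.mem_inter.1 hbY).1)⟩
      · exact Finset.mem_inter.2 ⟨(Finset.mem_inter.1 hb'Y').2, Finset.mem_union_left _ (Finset.mem_inter.1 hb'Y').1⟩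
    have := Finset.card_le_card hsub
    rwa [Finset.card_pair hne] at this
  have hcover : A ∪ B ∪ {v} ⊆ unionL [B, Y', Y, A] := by
    intro u hu
    simp only [unionL, Finset.union_empty]
    rcases Finset.mem_union.1 hu with hu | hu
    · rcases Finset.mem_union.1 hu with hu | hu
      · exact Finset.mem_union_right _ (Finset.mem_union_right _ (Finset.mem_union_right _ hu))
      · exact Finset.mem_union_left _ hu
    · rw [Finset.mem_singleton.1 hu]
      exact Finset.mem_union_right _ (Finset.mem_union_right _ (Finset.mem_union_left _ hvY))
  have hr4 : lineRank [X, B, Y', Y, A] = 3 := by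
    rw [lineRank_cons_of_two_le X [B, Y', Y, A] ?_, hr3]
    exact le_trans hX2 (Finset.card_le_card (Finset.inter_subset_inter le_rfl hcover))
  have hnd : [X, B, Y', Y, A].Nodup := by
    simp [hXA, hXB, hXY, hXY', hBA, hYA, hY'A, Ne.symm hYB, Ne.symm hY'B, Ne.symm hYY']
  have hc9 := h5 [X, B, Y', Y, A] hnd (by simp [hX, hB, hY', hY, hA]) (le_of_eq hr4)
  -- the plane has exactly `A ∪ B ∪ {v}`
  have hcard : (A ∪ B ∪ {v}).card = A.card + B.card + 1 := by
    rw [Finset.card_union_of_disjoint (Finset.disjoint_singleton_right.2 hv),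
      Finset.card_union_of_disjoint (Finset.disjoint_iff_inter_eq_empty.2 (by
        rw [Finset.inter_comm]; exact Finset.card_eq_zero.1 hdisj)), Finset.card_singleton]
  have hcover' : A ∪ B ∪ {v} ⊆ unionL [X, B, Y', Y, A] := fun u hu => by
    simp only [unionL, Finset.union_empty] at hcover ⊢
    exact Finset.mem_union_right _ (hcover hu)
  have heq : unionL [X, B, Y', Y, A] = A ∪ B ∪ {v} :=
    (Finset.eq_of_subset_of_card_le hcover' (by omega)).symm
  intro u hu
  rw [← heq]
  simp only [unionL]
  exact Finset.mem_union_left _ hu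

end Plane

end Eight

end FourCap

end S1

end PercRepro
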